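import Summits.AtomisticToContinuum.BoseEinsteinCondensation.Theses.BECThomsonPrinciple
import Summits.AtomisticToContinuum.BoseEinsteinCondensation.Theses.BECPeriodicReduction
import Literature.MathematicalPhysics.QuantumManyBody.SwapPurity
import Literature.MathematicalPhysics.QuantumManyBody.PeriodicHeatFlowSpectral
import Literature.Probability.Divergences.FDivVariational
import Literature.Barriers.AtomisticToContinuum.KineticGapLengthScales

/-!
# Sketch — crux idea `entropy-budget-swap-transfer` (crux stmt-AtomisticToContinuum-9483, round 2, ideator 4)

First lemmas of the line "relative-entropy method for the periodic → Dirichlet transfer":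

* `bathMeasure`, `condOverlap` — the bath law `Y ↦ ∫|Ψ(x,Y)|²dx · dY` of an `(n+1)`-body wave
  function and the conditional overlap `σ_Ψ(Y,Y') = |⟨ψ_{Y'}, ψ_Y⟩|²/(‖ψ_Y‖²‖ψ_{Y'}‖²) ∈ [0,1]` of
  the one-body conditional amplitudes `ψ_Y = Ψ(·, Y)`;
* `SwapPurityDisintegration` — the identity `tr γ_Ψ²/N² = swapPurity n Ψ = E_{Q⊗Q}[σ_Ψ]`
  (provable now: Tonelli + `swapPurity_eq_lintegral_lintegral`);
* `EntropyEventTransfer` — Csiszár/Yau entropy inequality `Q(A)·log(1/P(A)) ≤ KL(Q‖P) + 1`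
  (provable now from `Literature.Probability.Divergences.integral_le_toReal_klDiv_add_integral`
  with `g = log(1/P(A))·𝟙_A`);
* the residual cruxes `EntropyBudget` (R1, wall) and `DilationEntropyBudget` (R1′, dilation),
  `TorusOverlapConcentration` (R2), `OverlapStability` (R3), typed over existing declarations.
  Geometry: same `N` on the box of side `ℓ = L_N(ρ′)` and on the torus of side `ℓ + m` (fixed
  margin), reached from the `A`-torus of side `ℓ` by a dilation `s = 1 + m/ℓ → 1` — all entropy
  budgets are then `O(N^{2/3})`; a fixed density mismatch would cost `N^{4/3}`.
-/

noncomputable section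

namespace Summit.AtomisticToContinuum.BoseEinsteinCondensation.Cruxes.PeriodicToDirichlet.EntropySwap

open MeasureTheory InformationTheory Filter
open scoped ENNReal NNReal ComplexConjugate
open Literature.MathematicalPhysics.QuantumManyBody.BoseGas
open Summit.AtomisticToContinuum.BoseEinsteinCondensation.Theses

variable {n : ℕ}

/-- Bath law of an `(n+1)`-body wave function: the measure on `Config n` with Lebesgue density
`Y ↦ ∫ |Ψ(x :: Y)|² dx` (the `n`-particle marginal of `|Ψ|²`, first particle integrated out). -/
def bathMeasure (n : ℕ) (Ψ : Config (n + 1) → ℂ) : Measure (Config n) :=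
  volume.withDensity fun Y => ∫⁻ x, (‖Ψ (Matrix.vecCons x Y)‖₊ : ℝ≥0∞) ^ 2

/-- Conditional overlap of the one-body conditional amplitudes `ψ_Y = Ψ(·, Y)`, `ψ_{Y'}`:
`σ_Ψ(Y, Y') = |∫ conj Ψ(x,Y') Ψ(x,Y) dx|² / (∫|Ψ(x,Y)|²dx · ∫|Ψ(x,Y')|²dx) ∈ [0, 1]`
(`0/0 = 0`). Its `Q⊗Q`-mean is `tr γ_Ψ²/N²` (`SwapPurityDisintegration`). -/
def condOverlap (n : ℕ) (Ψ : Config (n + 1) → ℂ) (Y Y' : Config n) : ℝ≥0∞ :=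
  (‖∫ x, conj (Ψ (Matrix.vecCons x Y')) * Ψ (Matrix.vecCons x Y)‖₊ : ℝ≥0∞) ^ 2 /
    ((∫⁻ x, (‖Ψ (Matrix.vecCons x Y)‖₊ : ℝ≥0∞) ^ 2) *
      ∫⁻ x, (‖Ψ (Matrix.vecCons x Y')‖₊ : ℝ≥0∞) ^ 2)

/-- The torus ground state, cut to the fundamental cell and read as a complex wave function
(so that `bathMeasure`/`condOverlap`/`swapPurity` integrate over the cell). -/
def cellState (n : ℕ) (L : ℝ) (Φ : Config (n + 1) → ℝ) : Config (n + 1) → ℂ :=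
  (cellN (n + 1) L).indicator fun X => (Φ X : ℂ)

/-- (L1, provable now) **Disintegration of the swap purity**: `swapPurity n Ψ`
(`= tr γ_Ψ²/N²`, Penrose–Onsager's `A₂`) is the mean of the conditional overlap over two
INDEPENDENT baths drawn from the bath law. With `succ_mul_swapPurity_le_maxOccupation`
(`N · swapPurity ≤ λ_max`) this makes `λ_max(γ_Ψ)/N ≥ E_{Q⊗Q}[σ_Ψ]` — a mode-free BEC
certificate that is an EXPECTATION of a `[0,1]`-valued bath functional. -/
def SwapPurityDisintegration : Prop :=
  ∀ (n : ℕ) (Ψ : Config (n + 1) → ℂ), Measurable Ψ →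
    swapPurity n Ψ =
      ∫⁻ Y, ∫⁻ Y', condOverlap n Ψ Y Y' ∂(bathMeasure n Ψ) ∂(bathMeasure n Ψ)

/-- (L0, provable now) **Entropy–event transfer** (the one inequality of Yau's relative-entropy
method): an event that is exponentially rare for the reference law `P` stays rare for any law `Q`
of sub-exponential relative entropy — `Q(A) · log(1/P(A)) ≤ KL(Q‖P) + 1`. -/
def EntropyEventTransfer : Prop :=
  ∀ (α : Type) [MeasurableSpace α] (Q P : Measure α) [IsProbabilityMeasure Q]
    [IsProbabilityMeasure P] (A : Set α), MeasurableSet A → klDiv Q P ≠ ∞ → P A ≠ 0 →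
    (Q A).toReal * Real.log ((P A).toReal⁻¹) ≤ (klDiv Q P).toReal + 1

/-- (R1, crux) **Entropy budget of the wall** — for bounded `v` with `a > 0`, the bath law of a
Dirichlet `δ`-near-minimiser of the box of side `ℓ = L_N(ρ′)` (N particles) has Kullback–Leibler
divergence `o(N)` w.r.t. the bath law of the torus ground state of the SAME `N` particles on the
torus of side `ℓ + m` (fixed margin `m > R₀`: the box sits in the cell with no image
interactions, and the mean densities agree to `O(m/ℓ)`). The relative FISHER information is the
exact energy excess `∫|∇(Ψ/Φ)|²Φ² = energy(Ψ) − E₀^per(N, ℓ+m) = O(N^{2/3})` (wall + the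
`O((m/ℓ)²N^{4/3}) = O(N^{2/3})` macroscopic-compression cost); physically
`KL ≈ (#boundary-layer particles)·O(1) = O(Nξ/ℓ)`. Geometry matters: a FIXED density mismatch
(torus at `ρ < ρ′`) would cost `KL ≳ (1−ρ/ρ′)²N^{4/3}` (the torus ground state is macroscopically
incompressible in probability, `S(k) ≍ k`), so equal `N` and an `O(1)` margin are essential.
False at `v = 0` (`ξ = ∞`: `KL = 3(1 − log 2)N`), hence `0 < a`. -/
def EntropyBudget : Prop :=
  ∀ v : ℝ → ℝ≥0∞, IsRepulsiveFiniteRange v → (∃ B : ℝ, ∀ r, v r ≤ ENNReal.ofReal B) →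
    0 < scatteringLength v →
    ∃ ρ₁ : ℝ, 0 < ρ₁ ∧ ∀ ρ' : ℝ, 0 < ρ' → ρ' < ρ₁ → ∃ m₀ : ℝ, ∀ m : ℝ, m₀ ≤ m → ∀ ε : ℝ, 0 < ε →
      ∀ᶠ n : ℕ in atTop, ∃ δ : ℝ≥0∞, 0 < δ ∧
        ∀ Φ : Config (n + 1) → ℝ, IsPeriodicGroundStateFK v (sideLength ρ' (n + 1) + m) Φ →
        ∀ Ψ : TrialState (n + 1) (sideLength ρ' (n + 1)),
          energy v Ψ ≤ groundStateEnergy v (n + 1) (sideLength ρ' (n + 1)) + δ →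
          klDiv (bathMeasure n Ψ.ψ)
              (bathMeasure n (cellState n (sideLength ρ' (n + 1) + m) Φ)) ≠ ∞ ∧
          (klDiv (bathMeasure n Ψ.ψ)
              (bathMeasure n (cellState n (sideLength ρ' (n + 1) + m) Φ))).toReal ≤ ε * (n + 1)

/-- (R1′, crux, the dilation instance of the same inequality — replaces any uniformity-in-density
interface) **Entropy budget of a dilation**: on ONE torus of side `ℓ = L_N(ρ′)`, the ground state of
the dilated potential `ṽ_s(r) = s²v(sr)` (`= scaledPotential v s⁻¹`; by scaling it is the rescaled
ground state of `v` on the torus of side `sℓ = ℓ + m`) has bath law within `o(N)` KL of the bath law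
of the ground state of `v`, as `s = 1 + m/ℓ → 1` (Fisher budget `≤ ⟨Σ(ṽ_s − v)⟩`-differences
`= N·o(1)`, short-range deformation only — no macroscopic density mismatch at all). -/
def DilationEntropyBudget : Prop :=
  ∀ v : ℝ → ℝ≥0∞, IsRepulsiveFiniteRange v → (∃ B : ℝ, ∀ r, v r ≤ ENNReal.ofReal B) →
    ∃ ρ₁ : ℝ, 0 < ρ₁ ∧ ∀ ρ' : ℝ, 0 < ρ' → ρ' < ρ₁ → ∀ m : ℝ, 0 ≤ m → ∀ ε : ℝ, 0 < ε →
      ∀ᶠ n : ℕ in atTop,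
        ∀ Φ Φ' : Config (n + 1) → ℝ, IsPeriodicGroundStateFK v (sideLength ρ' (n + 1)) Φ →
          IsPeriodicGroundStateFK
            (Literature.Barriers.AtomisticToContinuum.BoseGas.scaledPotential v
              (sideLength ρ' (n + 1) / (sideLength ρ' (n + 1) + m)))
            (sideLength ρ' (n + 1)) Φ' →
          klDiv (bathMeasure n (cellState n (sideLength ρ' (n + 1)) Φ'))
              (bathMeasure n (cellState n (sideLength ρ' (n + 1)) Φ)) ≠ ∞ ∧
          (klDiv (bathMeasure n (cellState n (sideLength ρ' (n + 1)) Φ'))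
              (bathMeasure n (cellState n (sideLength ρ' (n + 1)) Φ))).toReal ≤ ε * (n + 1)

/-- (R2, crux) **Torus overlap concentration** — speed-`N` lower large-deviation bound for the
conditional overlap of the torus ground state (margin `m ≥ 0` so that both the `A`-torus `m = 0`
and the reference tori `m > 0` are covered): drawing two independent baths from `Φ²`, the event
"`σ_Φ` is below the fraction `θ` of its mean" has probability `≤ e^{-gN}` (the mean is
`tr γ_Φ²/N² ≥ (n₀/N)²`, which `PeriodicBEC` bounds below at `m = 0`; `σ_Φ = cos²∠(φ_Y, φ_{Y'})` is
an additive-type bulk functional of the two bath configurations — Jastrow level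
`log σ_Φ ≈ −2ρ∫(1−f)²`, fluctuations only from dimple overlaps, `Var(log σ) ≍ ρ³ξ⁹/N`; natural
proof route: Marton/Bobkov–Götze transport–entropy for `Φ²` (static stiffness) + bounded
differences, not Herbst/log-Sobolev). -/
def TorusOverlapConcentration : Prop :=
  ∀ v : ℝ → ℝ≥0∞, IsRepulsiveFiniteRange v → (∃ B : ℝ, ∀ r, v r ≤ ENNReal.ofReal B) →
    ∃ ρ₁ : ℝ, 0 < ρ₁ ∧ ∀ ρ' : ℝ, 0 < ρ' → ρ' < ρ₁ → ∀ m : ℝ, 0 ≤ m → ∀ θ : ℝ, 0 < θ → θ < 1 →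
      ∃ g : ℝ, 0 < g ∧ ∀ᶠ n : ℕ in atTop,
        ∀ Φ : Config (n + 1) → ℝ, IsPeriodicGroundStateFK v (sideLength ρ' (n + 1) + m) Φ →
          let Φc := cellState n (sideLength ρ' (n + 1) + m) Φ
          let P := bathMeasure n Φc
          (P.prod P) {p | condOverlap n Φc p.1 p.2 <
              ENNReal.ofReal θ * ∫⁻ q, condOverlap n Φc q.1 q.2 ∂(P.prod P)} ≤
            ENNReal.ofReal (Real.exp (-(g * (n + 1))))

/-- (R3, crux) **Overlap stability under the wall's Doob factor** — in `Q⊗Q`-measure the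
conditional overlaps of a Dirichlet near-minimiser (box of side `ℓ`) dominate those of the torus
ground state (same `N`, torus of side `ℓ + m`): `σ_Ψ ≥ κ σ_Φ − ε` off a set of `Q⊗Q`-mass `≤ ε`.
Content: `Ψ/Φ` is, in `L²`-measure, a one-body boundary-layer weight times a bath factor up to
small mixed terms; at the 4-point (swap) level the one-body factors cancel identically, and after
the `x`-integration they survive only as the weight `s(x)²dx` of the inner product, flat on the
bulk. (The dilation instance R3′ — two smooth positive torus ground states of `v` and `ṽ_s`,
`s → 1`, no wall — is the same statement with `Φ'` of R1′ in place of `Ψ`, and milder.) -/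
def OverlapStability : Prop :=
  ∀ v : ℝ → ℝ≥0∞, IsRepulsiveFiniteRange v → (∃ B : ℝ, ∀ r, v r ≤ ENNReal.ofReal B) →
    0 < scatteringLength v →
    ∃ ρ₁ : ℝ, 0 < ρ₁ ∧ ∀ ρ' : ℝ, 0 < ρ' → ρ' < ρ₁ → ∃ m₀ : ℝ, ∀ m : ℝ, m₀ ≤ m → ∀ ε : ℝ, 0 < ε →
      ∃ κ : ℝ, 0 < κ ∧ ∀ᶠ n : ℕ in atTop, ∃ δ : ℝ≥0∞, 0 < δ ∧
        ∀ Φ : Config (n + 1) → ℝ, IsPeriodicGroundStateFK v (sideLength ρ' (n + 1) + m) Φ →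
        ∀ Ψ : TrialState (n + 1) (sideLength ρ' (n + 1)),
          energy v Ψ ≤ groundStateEnergy v (n + 1) (sideLength ρ' (n + 1)) + δ →
          let Φc := cellState n (sideLength ρ' (n + 1) + m) Φ
          let Q := bathMeasure n Ψ.ψ
          (Q.prod Q) {p | condOverlap n Ψ.ψ p.1 p.2 + ENNReal.ofReal ε <
              ENNReal.ofReal κ * condOverlap n Φc p.1 p.2} ≤ ENNReal.ofReal ε

/-- Shape check: the crux is the route decl, and the conjunct is what the chain must reach. -/
example : BECThomsonPrinciple.PeriodicToDirichlet =
    (BECPeriodicReduction.PeriodicBEC → _root_.BoseEinsteinCondensation) := rfl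

end Summit.AtomisticToContinuum.BoseEinsteinCondensation.Cruxes.PeriodicToDirichlet.EntropySwap

end
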